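import Mathlib
import Literature.Analysis.FunctionSpaces.LogPoincareSmallSets
import HarnessLib

/-!
# Crux `EulerZoomLiouville.PowerGaugeEulerLiouville` (stmt-NavierStokesRegularity-19832), sub-line `casimir_haul` (H3 `stub_haulingInequality`):
# THE PER-SLICE ESTIMATE `|∫_{A} f| ≤ |A| ( ‖f‖_{L²(B_R)}/√(πR²) + √(C (1 + log(πR²/|A|)) ∫_{B_R} |∇f|²) )`

Route №10 `EulerZoomLiouville` (NavierStokesRegularity), crux E = stmt-NavierStokesRegularity-19832; width seat ns-ezl-w2 g7 under the LEAD ns-typeII-p2.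
H3 slices the solid cylinder along `x₃ = z`; on each slice one needs, for the planar function `f = v₃(·, z) ∈ C¹(ℝ²)` and the slice set
`A = A_z ⊆ B_R` (`R = 2b`), a bound on `|∫_A f|` by the slice area `|A|` times [mean of `f` over the disc + the log-Poincaré deviation].
This file is that step, from H2 (`Literature.Analysis.FunctionSpaces.logPoincare_smallSets`):

* `abs_setAverage_le_sqrt` — `|⨍_B f| ≤ √(∫_B f²) / √|B|` (Cauchy–Schwarz);
* `abs_setIntegral_le_slice` — ★ `∃ C > 0, ∀ R > 0, ∀ f ∈ C¹(ℝ²), ∀ A ⊆ B(0,R)` measurable: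
  `|∫_A f| ≤ |A| (√(∫_{B_R} f²)/√(πR²) + √(C (1 + log(πR²/|A|)) ∫_{B_R} ‖Df‖²))` (for `|A| = 0` both sides vanish).
[folklore; Gilbarg–Trudinger 2001 §7.8 for the ingredient H2]

WHAT THIS IS NOT: not NS, not E, not H3 — a planar brick `--supports` stmt-19832; 19832 is OPEN.
-/

noncomputable section

-- flat `Theorems/<Route><Decl>…` files of one crux share the namespace of the crux (tree convention)
set_option linter.dupNamespace false

open MeasureTheory Set Filter Metric Real
open scoped ENNReal Topology

namespace Summit.NavierStokesRegularity.NavierStokesRegularity.Theorems.PowerGaugeEulerLiouville.CasimirHaul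

/-- **Cauchy–Schwarz for averages over a disc**: `|⨍_{B(0,R)} f| ≤ √(∫_{B(0,R)} f²)/√(πR²)` for `f` continuous (`R > 0`). [folklore] -/
theorem abs_setAverage_le_sqrt {R : ℝ} (hR : 0 < R) {f : EuclideanSpace ℝ (Fin 2) → ℝ} (hf : Continuous f) :
    |⨍ x in ball (0 : EuclideanSpace ℝ (Fin 2)) R, f x| ≤
      Real.sqrt (∫ x in ball (0 : EuclideanSpace ℝ (Fin 2)) R, f x ^ 2) / Real.sqrt (π * R ^ 2) := by
  set B : Set (EuclideanSpace ℝ (Fin 2)) := ball (0 : EuclideanSpace ℝ (Fin 2)) R with hBdef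
  have hBvol : (volume : Measure (EuclideanSpace ℝ (Fin 2))).real B = π * R ^ 2 := by
    rw [measureReal_def, hBdef, EuclideanSpace.volume_ball_fin_two, ← ENNReal.ofReal_pow hR.le, ← ENNReal.ofReal_mul (by positivity),
      ENNReal.toReal_ofReal (by positivity)]
    ring
  have hBpos : 0 < π * R ^ 2 := by positivity
  haveI : IsFiniteMeasure ((volume : Measure (EuclideanSpace ℝ (Fin 2))).restrict B) :=
    isFiniteMeasure_restrict.2 measure_ball_lt_top.ne
  -- `f` is bounded on the ball, hence in every `L^p(B)`
  have hfK : IntegrableOn f B volume :=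
    (hf.continuousOn.integrableOn_compact (isCompact_closedBall (0 : EuclideanSpace ℝ (Fin 2)) R)).mono_set ball_subset_closedBall
  have hf2 : MemLp f 2 (volume.restrict B) := by
    obtain ⟨C, hC⟩ := (isCompact_closedBall (0 : EuclideanSpace ℝ (Fin 2)) R).exists_bound_of_continuousOn hf.continuousOn
    exact MemLp.of_bound hfK.aestronglyMeasurable C
      (ae_restrict_of_forall_mem measurableSet_ball fun x hx => hC x (ball_subset_closedBall hx))
  -- Cauchy–Schwarz `∫_B |f| · 1 ≤ (∫ |f|²)^{1/2} (∫ 1²)^{1/2}`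
  have hf2a : MemLp (fun x => |f x|) (ENNReal.ofReal 2) (volume.restrict B) := by
    rw [ENNReal.ofReal_ofNat]; exact hf2.abs
  have h1m : MemLp (fun _ : EuclideanSpace ℝ (Fin 2) => (1 : ℝ)) (ENNReal.ofReal 2) (volume.restrict B) := memLp_const 1
  have hCS := integral_mul_le_Lp_mul_Lq_of_nonneg (μ := volume.restrict B) Real.HolderConjugate.two_two
    (f := fun x => |f x|) (g := fun _ => (1 : ℝ))
    (Eventually.of_forall fun x => abs_nonneg _) (Eventually.of_forall fun _ => zero_le_one) hf2a h1m
  have e1 : ∫ x in B, |f x| ^ (2 : ℝ) = ∫ x in B, f x ^ 2 := by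
    refine integral_congr_ae (Eventually.of_forall fun x => ?_)
    dsimp only
    rw [Real.rpow_two, sq_abs]
  have e2 : ∫ _ in B, (1 : ℝ) ^ (2 : ℝ) = π * R ^ 2 := by
    rw [Real.one_rpow, setIntegral_const, hBvol, smul_eq_mul, mul_one]
  simp only [mul_one] at hCS
  rw [e1, e2, ← Real.sqrt_eq_rpow, ← Real.sqrt_eq_rpow] at hCS
  -- `|⨍ f| = (πR²)⁻¹ |∫ f| ≤ (πR²)⁻¹ ∫ |f|`
  rw [setAverage_eq, hBvol, smul_eq_mul, abs_mul, abs_of_pos (inv_pos.2 hBpos)]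
  have h1 : |∫ x in B, f x| ≤ ∫ x in B, |f x| := abs_integral_le_integral_abs
  have hsq : Real.sqrt (π * R ^ 2) * Real.sqrt (π * R ^ 2) = π * R ^ 2 := Real.mul_self_sqrt hBpos.le
  have hspos : 0 < Real.sqrt (π * R ^ 2) := Real.sqrt_pos.2 hBpos
  calc (π * R ^ 2)⁻¹ * |∫ x in B, f x| ≤ (π * R ^ 2)⁻¹ * (Real.sqrt (∫ x in B, f x ^ 2) * Real.sqrt (π * R ^ 2)) := by
        gcongr; exact h1.trans hCS
    _ = Real.sqrt (∫ x in B, f x ^ 2) / Real.sqrt (π * R ^ 2) := by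
        rw [eq_div_iff hspos.ne']
        calc (π * R ^ 2)⁻¹ * (Real.sqrt (∫ x in B, f x ^ 2) * Real.sqrt (π * R ^ 2)) * Real.sqrt (π * R ^ 2)
            = (π * R ^ 2)⁻¹ * Real.sqrt (∫ x in B, f x ^ 2) * (Real.sqrt (π * R ^ 2) * Real.sqrt (π * R ^ 2)) := by ring
          _ = (π * R ^ 2)⁻¹ * Real.sqrt (∫ x in B, f x ^ 2) * (π * R ^ 2) := by rw [hsq]
          _ = Real.sqrt (∫ x in B, f x ^ 2) := by field_simp

/-- **THE PER-SLICE ESTIMATE** (from the planar log-Poincaré inequality H2): there is `C > 0` such that for every `R > 0`, every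
`f ∈ C¹(ℝ²)` and every measurable `A ⊆ B(0,R)`,
`|∫_A f| ≤ |A| ( √(∫_{B_R} f²)/√(πR²) + √(C (1 + log(πR²/|A|)) ∫_{B_R} ‖Df‖²) )`. [folklore] -/
theorem abs_setIntegral_le_slice :
    ∃ C : ℝ, 0 < C ∧ ∀ R : ℝ, 0 < R → ∀ f : EuclideanSpace ℝ (Fin 2) → ℝ, ContDiff ℝ 1 f →
      ∀ A : Set (EuclideanSpace ℝ (Fin 2)), MeasurableSet A → A ⊆ ball (0 : EuclideanSpace ℝ (Fin 2)) R →
        |∫ x in A, f x| ≤ (volume A).toReal *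
          (Real.sqrt (∫ x in ball (0 : EuclideanSpace ℝ (Fin 2)) R, f x ^ 2) / Real.sqrt (π * R ^ 2) +
            Real.sqrt (C * (1 + Real.log (π * R ^ 2 / (volume A).toReal)) *
              ∫ x in ball (0 : EuclideanSpace ℝ (Fin 2)) R, ‖fderiv ℝ f x‖ ^ 2)) := by
  obtain ⟨C, hC, hLP⟩ := Literature.Analysis.FunctionSpaces.logPoincare_smallSets
  refine ⟨C, hC, fun R hR f hf A hA hAB => ?_⟩
  have hAfin : volume A ≠ ⊤ := ((measure_mono hAB).trans_lt measure_ball_lt_top).ne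
  rcases eq_or_ne (volume A) 0 with h0 | h0
  · -- null slice: both sides vanish
    rw [setIntegral_measure_zero _ h0, h0]
    simp
  -- the genuine case
  set m : ℝ := (volume A).toReal with hmdef
  have hm : 0 < m := ENNReal.toReal_pos h0 hAfin
  have hLPA := hLP R hR f hf A hA hAB (pos_iff_ne_zero.2 h0)
  have hdev : |(⨍ x in A, f x) - ⨍ x in ball (0 : EuclideanSpace ℝ (Fin 2)) R, f x| ≤
      Real.sqrt (C * (1 + Real.log (π * R ^ 2 / m)) * ∫ x in ball (0 : EuclideanSpace ℝ (Fin 2)) R, ‖fderiv ℝ f x‖ ^ 2) := by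
    have h := Real.abs_le_sqrt hLPA
    rwa [abs_abs] at h
  have hmean := abs_setAverage_le_sqrt hR hf.continuous
  -- `∫_A f = |A| ⨍_A f`
  have hint : ∫ x in A, f x = m * ⨍ x in A, f x := by
    rw [setAverage_eq, measureReal_def, ← hmdef, smul_eq_mul, ← mul_assoc, mul_inv_cancel₀ hm.ne', one_mul]
  rw [hint, abs_mul, abs_of_pos hm]
  refine mul_le_mul_of_nonneg_left ?_ hm.le
  calc |⨍ x in A, f x|
      = |(⨍ x in ball (0 : EuclideanSpace ℝ (Fin 2)) R, f x) + ((⨍ x in A, f x) - ⨍ x in ball (0 : EuclideanSpace ℝ (Fin 2)) R, f x)| := by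
        rw [add_sub_cancel]
    _ ≤ |⨍ x in ball (0 : EuclideanSpace ℝ (Fin 2)) R, f x| + |(⨍ x in A, f x) - ⨍ x in ball (0 : EuclideanSpace ℝ (Fin 2)) R, f x| :=
        abs_add_le _ _
    _ ≤ _ := add_le_add hmean hdev

end Summit.NavierStokesRegularity.NavierStokesRegularity.Theorems.PowerGaugeEulerLiouville.CasimirHaul

end
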